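import Summits.SmoothPoincare4.SmoothPoincare4.Theses.CylinderEntropy
import Literature.Geometry.Riemannian.LowEntropyHypersurfacesFourProofs
import Literature.Geometry.Riemannian.LowEntropyHypersurfacesFourAssembly
import Literature.Geometry.Riemannian.SphericalCylinderEntropy
import Literature.Geometry.Riemannian.SphericalCylinderSmallScaleDominationProofs
import Summits.SmoothPoincare4.SmoothPoincare4.Theorems.CylinderEntropySliceIsolationStubConformalEmbedding
import Summits.SmoothPoincare4.SmoothPoincare4.Theorems.CylinderEntropySliceIsolationReduction
import Summits.SmoothPoincare4.SmoothPoincare4.Theorems.CylinderEntropySliceIsolationStubCertLarge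
import Summits.SmoothPoincare4.SmoothPoincare4.Theorems.CylinderEntropySliceIsolationStubCertSmall
import Summits.SmoothPoincare4.SmoothPoincare4.Theorems.CylinderEntropySliceIsolationStubDominationBookkeeping
import Summits.SmoothPoincare4.SmoothPoincare4.Theorems.CylinderEntropySliceIsolationStubCertMidLow
import Summits.SmoothPoincare4.SmoothPoincare4.Theorems.CylinderEntropySliceIsolationStubCertMidLow2
import Summits.SmoothPoincare4.SmoothPoincare4.Theorems.CylinderEntropySliceIsolationStubCertMidLow3
import Summits.SmoothPoincare4.SmoothPoincare4.Theorems.CylinderEntropySliceIsolationStubCertHigh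
import Summits.SmoothPoincare4.SmoothPoincare4.Theorems.CylinderEntropySliceIsolationStubCertHigh2
import Summits.SmoothPoincare4.SmoothPoincare4.Theorems.CylinderEntropySliceIsolationStubCertMidA
import Summits.SmoothPoincare4.SmoothPoincare4.Theorems.CylinderEntropySliceIsolationStubCertMidB
import Summits.SmoothPoincare4.SmoothPoincare4.Theorems.CylinderEntropySliceIsolationStubCertMidC
import Summits.SmoothPoincare4.SmoothPoincare4.Theorems.CylinderEntropyCylinderRungTwoReduction
import Summits.SmoothPoincare4.SmoothPoincare4.Theorems.CylinderEntropySliceIsolationStubSeparationPersists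
import Literature.Geometry.Riemannian.WhiteLocalRegularityCylinderFlow
import Literature.Topology.FourManifolds.HomotopyS4CompactProofs
import Literature.Topology.FourManifolds.HomotopyS4SimplyConnected
import Literature.Topology.FourManifolds.SphereSimplyConnected
import HarnessLib
import HarnessLib.Audit

/-!
# Line `conformal-kernel-domination` — crux `CylinderEntropy.SliceIsolation` (stmt-SmoothPoincare4-7632)

LEAD RESHAPE r12, continuation lead c9 (prover-line-stmt-SmoothPoincare4-7632-c9-0, 2026-08-17T13Z), two changes to the registered
r10 skeleton and nothing else: (r11) γ3 `stub_separationPersists` is no longer a stub — it LANDED verbatim as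
`Summit.SmoothPoincare4.SmoothPoincare4.Theorems.CylinderEntropySliceIsolation.stub_separationPersists`
(`Theorems/CylinderEntropySliceIsolationStubSeparationPersists.lean`, p145458 + Aux1–8; whitelist axioms), imported and used by name
in `SliceIsolation_of_thinFlow`; (r12) γ1 `stub_thinFlowImmortal` is RE-CUT with the crux's own end-separation hypothesis
`SeparatesEnds (range ι)` added (the composition holds it as `hsep`, so the chain is unchanged and the stub is strictly WEAKER).
Why the re-cut is a correction and not cosmetics: without the separation clause γ1 silently asserts, in addition to the analytic
package, that NO `δ`-thin closed connected cross-section bounds a compact pocket of `N` — for a pocket boundary `∂Ω` the smooth flow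
cannot be immortal-and-regular (an immortal `(1+δ)`-thin flow has curvature bounded for `t ≥ 1` by White, cannot go extinct without a
shrinking-sphere density `Λ₄ = 1.44 > 1 + δ` (Hamilton monotonicity), and every subsequential limit is a closed minimal hypersurface of
entropy `≤ 1 + δ`, i.e. ONE slice, which a pocket boundary — even vertical crossing parity — cannot converge to); so "no thin pockets"
is TRUE, but only as a corollary of the full long-time theory, a second hidden debt riding on γ1.  With `SeparatesEnds (range ι)` in the
hypothesis, γ1 is exactly the printed forward package {short-time existence from a smooth closed initial hypersurface of `N`,
preserved embeddedness, Hamilton monotonicity (PROVED), White's a-priori estimate up to the maximal time, continuation, Seeley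
extension below `t = 0`} and nothing topological.  Registered stubs after r12 (6 ≤ stubs_max): `stub_cor15bFour` (β, named fact),
`stub_certMidA/B/C` (β, landed computationally p131267/p131268/p130905 — open only for a kernel-clean proof), `stub_thinFlowImmortal`
(γ1 re-cut, classical PDE package, crux-sized: promote-stub requested by c8, re-requested with this signature), `stub_white2005`
(γ2, named fact).  State of the crux: kernel-checked closed modulo EITHER {CMS 2025 Cor. 1.5 (b)} (β: `SliceIsolation_of`,
computational cone) OR {γ1, White 2005} (γ: `SliceIsolation_of_thinFlow`, whitelist axioms); no `_holds` exists for either named fact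
(re-verified 2026-08-17T13:20Z), Disproof.lean unchanged since 2026-08-16T04:57Z (no `-- Targets` theorem on a β/γ stub).

LEAD RESHAPE r10, continuation lead c8 (prover-line-stmt-SmoothPoincare4-7632-c8-0, 2026-08-17): a SECOND closing chain γ
("thin-flow graphicality") is registered next to β, assembled from the LANDED killing-flux machinery of the sibling crux
`CylinderRungTwo` (stmt-SmoothPoincare4-7631): `SliceIsolation_of_thinFlow : SliceIsolation` from the three new registered stubs
`stub_thinFlowImmortal` (γ1 · the mean curvature flow in `N` from a `δ`-thin separating cross-section of a compact connected `M`
exists as a smooth flow `IsCylinderMCF M F ν 0` of separating cross-section embeddings of `M` for all `t ≥ 0` — the classical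
package short-time existence / preserved embeddedness / Hamilton monotonicity (PROVED in the tree) / White's a-priori estimate /
continuation; pure PDE, no surgery, no genericity, no topology of `M`), `stub_separationPersists` (γ3 · end-separation persists along
the flow: isotopy invariance, elementary topology) and `stub_white2005` (γ2 · the
EXISTING named fact `Literature.Geometry.Riemannian.White2005_localRegularity_cylinderFlowSheet`), through the LANDED helper
`helper_sliceIsolationOfThinFlow` (`Theorems/CylinderEntropySliceIsolationOfThinFlow.lean`, p137301; kernel-clean: whitelist axioms,
no certificates): entropy is non-increasing along the flow (Hamilton), White + the landed tilt gap make the normal nowhere horizontal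
at `t = 1`, the shadow is a one-sheeted immersion (landed `stub_oneSheet`), a graphical cross-section is `S⁴` (landed
`stub_graphicalIsSphere`); `ε = min(δ, ε_gap)`.  So the crux is now kernel-checked closed modulo EITHER {CMS Cor. 1.5 (b)} (chain β,
computational) OR {γ1, White 2005} (chain γ, whitelist axioms).  A static (flow-free) γ is impossible: for every `ε` there are
`(1+ε)`-thin cross-sections isotopic to a slice with an exactly vertical tangent plane (a kink turning by `O(√ε)` per dyadic scale).
Registered stubs after r10 (7 = stubs_max): `stub_cor15bFour` (β, named fact), `stub_certMidA/B/C` (β, landed computationally),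
`stub_thinFlowImmortal` (γ1, classical PDE package, XL), `stub_separationPersists` (γ3, topology, L), `stub_white2005` (γ2, named fact);
`stub_slabConfinement` (α, redundant) is unregistered (kept as the hypothesis `SlabConfinementStatement` of `SliceIsolation_of_slab`).

LEAD SKELETON, continuation lead c3 (prover-line-stmt-SmoothPoincare4-7632-c3-0, re-picked 2026-08-16; `PICKED.md`), on the c2 skeleton:
reshape r9 = STUB 0 WEAKENED from the conjunction `ChodoshMantoulidisSchulze2025_lowEntropy_sphere_four` (Cor. 1.5 (a) ∧ (b),
`n = 4`) to its second conjunct alone, the tree's named fact `ChodoshMantoulidisSchulze2025_cor15b_four`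
(`Literature/Geometry/Riemannian/LowEntropyHypersurfacesFourAssembly.lean`: Cor. 1.5 (b) = Cor. 1.22 (b), `n = 4`, simply
connected case) — the only clause chain β ever applies; the conditional `helper_sliceIsolationOfCor15b : cor15b → SliceIsolation`
(`Theorems/CylinderEntropySliceIsolationOfCor15b.lean`) replaces c2's `helper_sliceIsolationOfCMS` (p131364) as the line's end
product. History: c2's reshape r8 split the last open β stub `stub_certMid` (`10⁻² ≤ T ≤ 10`, computational) into the decade
stubs `stub_certMidA/B/C`, ALL THREE LANDED 2026-08-16 (p131267, p131268, p130905: LP certificates accepted by the kernel-sound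
computable checker `Cert.checkCover` of `Theorems/CylinderEntropySliceIsolationCertCheck*.lean`, evaluated by `native_decide`).
CHAIN β IS COMPLETE AS A COMPUTATIONAL RESULT: modulo STUB 0 (the named published fact = classical debt, not dischargeable in the
tree: no mean curvature flow with surgery) every β stub is in the tree — but `stub_certMidA/B/C` landed by `native_decide`
(`--computational`), whose auxiliary axioms are outside the closing whitelist {propext, Classical.choice, Quot.sound}: the skeleton
check rejects a composition importing them (skeleton.axiom), so they are kept `sorry` HERE = open for a kernel-clean proof (the
only β work left besides the debt). `stub_slabConfinement` serves the redundant chain α only.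

THE CRUX (route `CylinderEntropy`, rank 3): `∃ ε > 0`, every smooth embedding `ι` of a homotopy 4-sphere `M` into
`N = S⁴ × ℝ = {z ∈ ℝ⁶ | ∑_{i<5} zᵢ² = 1}` separating the two ends with typed cylinder entropy `λ_cyl(range ι) < 1 + ε`
has `M ≃ₘ S⁴`.

THE LINE. The conformal diffeomorphism `Φ : N → ℝ⁵ ∖ {0}`, `Φ(x, s) = eˢ x` sends slices to round spheres
(`λ(S⁴) = 32/(3e²) = 1.4436`); `Φ ∘ ι` is a smooth embedding into `ℝ⁵` (`stub_conformalEmbedding`, LANDED p74486); if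
the Colding–Minicozzi entropy of `Φ(range ι)` is `≤ λ(S² × ℝ²) = 4/e = 1.4715`, the vendored theorem of
Chodosh–Mantoulidis–Schulze (Duke 2025, Cor. 1.5 (b), `n = 4`; tree NAMED FACT
`ChodoshMantoulidisSchulze2025_lowEntropy_sphere_four`; its clause (b) `ChodoshMantoulidisSchulze2025_cor15b_four` is registered as
STUB 0 = classical debt) gives `M ≃ₘ S⁴`.

TWO REGISTERED CLOSING CHAINS (reshape r4, lead c1).
* CHAIN α (inherited from lead gen 0; tree `Theorems/CylinderEntropySliceIsolationReduction.lean`, p83106):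
  CMS + Cheeger–Yau + SLAB CONFINEMENT ⇒ crux, with small scales by `smallScaleDomination` (p76567) and unit/large scales
  by `stub_groundStateContinuity` (p81658/p82481). The Cheeger–Yau fact is now DISCHARGED in the tree
  (`CheegerYauZonalSphereFour_holds`), so α is closed modulo {STUB 0, `stub_slabConfinement`}; slab confinement (Hausdorff
  stability of the slices under `λ_cyl ≤ 1 + ε`) is TRUE (drefute g1/g2) but its only known proof is the route's RUNG-0
  parabolic package — promoted by gen 0, kept registered here, not assigned (`SliceIsolation_of_slab`).
* CHAIN β (NEW, flow-free and GMT-free; the chain `SliceIsolation_of` uses): ALL-SCALES KERNEL DOMINATION WITH SLACK.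
  In normalised variables (`T = t/‖y‖²`, `u = z₅ - log ‖y‖`, `c = ⟨z', ŷ⟩`) the Jacobian-weighted pulled-back Euclidean
  kernel is `V (4πT)⁻² e^{4u} exp(-(e^{2u} - 2eᵘc + 1)/4T)` (`V = 8π²/3`); a CERTIFICATE at scale `T` is a finite family of
  on-axis cylinder kernels `w_j · 𝔥(τ_j, c) e^{-(u-σ_j)²/4τ_j}` plus an area atom `c_∞` dominating it pointwise on
  `ℝ × [-1, 1]`, of total mass `∑ w_j + c_∞ ≤ 147/100 < 4/e`. Certificates at every `T > 0` (`stub_certSmall`: `T ≤ 10⁻⁵`,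
  ONE atom, the tree's `near_*`/`far_bound` machinery with `(ε, κ, c_∞) = (1/25, 9/100, 1/20)`; `stub_certLarge`: `T ≥ 4·10⁴`,
  area atom ALONE, `sup = Λ₄(1 + r*/8T)² e^{(r*-1)/4T} ≤ 1.454`; `stub_certMid`: `10⁻⁵ ≤ T ≤ 4·10⁴`, LP certificates with
  `≤ 20` atoms — a finite inequality family over a compact box, COMPUTATIONAL, to be certified by interval arithmetic) give,
  by pure measure bookkeeping (`stub_dominationBookkeeping`, lead; pattern of the landed `smallScaleDomination_of_cheegerYau`:
  layer-cake pushforward `μHE⁴⌊Φ(A) ≤ e^{4h}Φ_#(e^{4s}μHE⁴⌊A)`, certificate at `T = t/‖y‖²` with centres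
  `(ŷ, log ‖y‖ + σ_j)`, `V⁻¹∫_A K = F̂ ≤ λ_cyl`, `V⁻¹μHE⁴(A) = μH⁴(A)/μH⁴(S⁴) ≤ λ_cyl` for bounded height, centre `y = 0`
  by the landed `gaussianArea_zero_conformal_le`), `λ_E(Φ A) ≤ 1.47 λ_cyl(A)` for every bounded measurable `A ⊆ N`, whence
  the crux with `ε = 4/(1.47 e) - 1` (`sliceIsolation_of_dominationBounded`, PROVED here). Numerics (this seat, `num/`):
  optimal on-axis certificates have mass `1.10 … 1.29` for `T ∈ [10⁻⁵, 3·10⁻⁴]` (1 atom), `≤ 1.457` for `T ≥ 1`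
  (flat + 1–2 atoms), and gen 0's LP grid gives `≤ 1.4435` on `T ∈ [10⁻², 10²]`; `y = 0` is exactly `Λ₄` (landed).

DISPROOF USED (`Cruxes/SliceIsolation/Disproof.lean`, refuter-cdisprove, 2026-08-16T04:57Z): (i) `0 < ε` load-bearing —
β produces the explicit `ε = 4/(1.47e) - 1 > 0`, α `min(ε_unit, ε_slab, 1/100)`; (ii) `M ≃ₕ S⁴` load-bearing as
compactness/connectedness — used for `CompactSpace/PathConnectedSpace/SimplyConnectedSpace M` (CMS (b) needs all three) and
for the bounded height of `range ι` in β; (iii) `IsSmoothEmbedding` load-bearing — enters at `stub_conformalEmbedding` → CMS;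
(iv) entropy floor / calibration (`one_le_cylEntropy_slice`, `measure_ratio_le_cylEntropy`) — the area atom of every
certificate is exactly `measure_ratio_le_cylEntropy`; slices are the equality case of β at `y = 0` (constant `Λ₄` cannot be
lowered: landed `entropyDomination_false_of_const_lt_of_sliceCalibration`), consistent with `147/100 ≥ Λ₄`;
(v) landed `Negative/*`: `smallScaleDomination_false_without_slab…` concerns the `(1+δ)`-constant at small ABSOLUTE scales,
not β (β's constant is `1.47` at all scales, no slab). No `_false_without_` theorem is contradicted.
-/

noncomputable section

open MeasureTheory Set
open scoped Manifold ContDiff ENNReal Topology BigOperators ContinuousMap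

namespace Summit.SmoothPoincare4.SmoothPoincare4.Cruxes.SliceIsolation.ConformalKernelDomination

open Literature.Geometry.Riemannian
open Literature.Geometry.Riemannian.SphericalCylinderEntropy (cylKernel cylDensity cylEntropy zonal
  measure_ratio_le_cylEntropy hausdorffMeasure_sphere_four_pos hausdorffMeasure_sphere_four_lt_top)
open Summit.SmoothPoincare4.SmoothPoincare4.Theses.CylinderEntropy (SliceIsolation)

set_option linter.dupNamespace false

local notation "E5" => EuclideanSpace ℝ (Fin 5)
local notation "E6" => EuclideanSpace ℝ (Fin 6)

/-! ## The objects -/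

/-- The round cylinder `N = S⁴ × ℝ ⊂ ℝ⁶`, exactly as typed in the route items. -/
def cylN : Set E6 := {z | ∑ i : Fin 5, z (Fin.castSucc i) ^ 2 = 1}

/-- The typed end-separation predicate of the route items. -/
def SeparatesEnds (A : Set E6) : Prop :=
  ∃ R : ℝ, ∀ a b : E6, ∑ i : Fin 5, a (Fin.castSucc i) ^ 2 = 1 → ∑ i : Fin 5, b (Fin.castSucc i) ^ 2 = 1 →
    a 5 ≤ -R → R ≤ b 5 →
      ¬ JoinedIn ({z : EuclideanSpace ℝ (Fin 6) | ∑ i : Fin 5, z (Fin.castSucc i) ^ 2 = 1} \ A) a b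

/-- The conformal diffeomorphism `Φ : N → ℝ⁵ ∖ {0}`, `Φ(x, s) = eˢ x`, written on all of `ℝ⁶`. -/
def conformalMap (z : E6) : E5 :=
  WithLp.toLp 2 (fun i : Fin 5 => Real.exp (z 5) * z (Fin.castSucc i))

/-- The Jacobian-weighted pulled-back Euclidean kernel in normalised variables, times `V = 8π²/3`:
`V (4πT)⁻² e^{4u} exp(-(e^{2u} - 2 eᵘ s + 1)/(4T))` (`T = t/‖y‖²`, `u = z₅ - log ‖y‖`, `s = ⟨z', ŷ⟩`). -/
def pulled (T u s : ℝ) : ℝ :=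
  (8 * Real.pi ^ 2 / 3) * ((4 * Real.pi * T) ^ 2)⁻¹ * Real.exp (4 * u) *
    Real.exp (-(Real.exp (2 * u) - 2 * Real.exp u * s + 1) / (4 * T))

/-- A zonal CERTIFICATE of mass `≤ C` at normalised scale `T`: finitely many on-axis cylinder kernels
`w_j 𝔥(τ_j, s) e^{-(u-σ_j)²/4τ_j}` plus an area atom `c` dominate `pulled T` on `ℝ × [-1, 1]`. -/
def CertAt (C T : ℝ) : Prop :=
  ∃ (n : ℕ) (σ τ w : Fin n → ℝ) (c : ℝ), (∀ j, 0 < τ j) ∧ (∀ j, 0 ≤ w j) ∧ 0 ≤ c ∧ (∑ j, w j) + c ≤ C ∧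
    ∀ u s : ℝ, -1 ≤ s → s ≤ 1 →
      pulled T u s ≤ (∑ j, w j * (zonal (τ j) s * Real.exp (-(u - σ j) ^ 2 / (4 * τ j)))) + c

/-- ALL-SCALES CONFORMAL DOMINATION with constant `C`, for bounded measurable subsets of `N`:
`λ_E(Φ A) ≤ C · λ_cyl(A)`. -/
def EntropyDominationBounded (C : ℝ) : Prop :=
  ∀ A : Set E6, A ⊆ cylN → MeasurableSet A → (∃ B : ℝ, ∀ z ∈ A, |z 5| ≤ B) →
    gaussianEntropy 4 (conformalMap '' A) ≤ ENNReal.ofReal C * cylEntropy A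

/-! ## Registered stubs (self-contained statements; `sorry` only here) -/

/-- STUB 0 · NAMED CLASSICAL DEBT (chain β; reshape r9, lead c3): the tree's named fact
`ChodoshMantoulidisSchulze2025_cor15b_four` (CMS, Duke Math. J. 174 (2025), Cor. 1.5 (b) = Cor. 1.22 (b), `n = 4`, simply connected
case: a simply connected closed connected embedded hypersurface of `ℝ⁵` with `λ ≤ λ(𝕊²(2) × ℝ²) = 4/e` is diffeomorphic to `𝕊⁴`) —
the second conjunct, verbatim, of the former STUB 0 `ChodoshMantoulidisSchulze2025_lowEntropy_sphere_four`, and the only clause the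
chain applies. Not a lemma to prove (its proof is the mean curvature flow WITH SURGERY of Daniels-Holgate, absent from the tree); the
closing theorem carries it as a hypothesis by name. [cite: ChodoshMantoulidisSchulze2025, Cor. 1.5 (b)] -/
theorem stub_cor15bFour : ChodoshMantoulidisSchulze2025_cor15b_four := by
  sorry

/-- STUB γ1 · IMMORTALITY OF THIN SEPARATING CROSS-SECTION FLOWS (chain γ; introduced at reshape r10 by lead c8, RE-CUT at reshape
r12 by lead c9 with the end-separation hypothesis; size XL, CLASSICAL ANALYTIC PACKAGE — pure forward PDE).  There is `δ > 0` such that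
for every compact connected smooth `4`-manifold `M` and every smooth embedding `ι : M → N = S⁴ × ℝ ⊂ ℝ⁶` whose image SEPARATES THE
TWO ENDS of `N` (the crux's typed `JoinedIn` clause, = `KillingFlux.SeparatesEnds (range ι)` by `rfl`) and has typed cylinder entropy
`λ_cyl(range ι) < 1 + δ`, the mean curvature flow of `ι(M)` in `N` exists for all time as a smooth flow of cross-section EMBEDDINGS OF
`M` starting at `ι`: an `IsCylinderMCF M F ν 0` (the landed vocabulary of crux 7631,
`Theorems/CylinderEntropyCylinderRungTwoKillingFluxDefs.lean`: jointly smooth family on an open set `⊇ [0, ∞) × M`, each `F t` a smooth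
embedding into `N` and a Euclidean immersion, `ν t` a smooth unit normal tangent to `N`, `∂ₜF = -H ν`) with `F 0 = ι`.
WHY THE SEPARATION CLAUSE (r12): the composition `SliceIsolation_of_thinFlow` holds it (`hsep`), so adding it costs nothing and makes the
stub strictly weaker; WITHOUT it the stub also covers `δ`-thin boundaries `∂Ω` of compact pockets `Ω ⊂ N`, for which an immortal
regular flow is impossible (vertical crossing parity is even, so `∂Ω_t` cannot converge to the single slice that every immortal
`(1+δ)`-thin flow with White's curvature bound must sub-converge to, and it cannot go extinct either: a vanishing component passes
through the shrinking-sphere density `Λ₄ = 32/(3e²) = 1.44 > 1 + δ`, excluded by Hamilton's monotonicity) — so the un-cut stub was true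
only because "no `δ`-thin pocket boundary exists", itself a corollary of the whole long-time theory: a second, hidden, crux-sized
debt.  A separating cross-section is automatically two-sided in `N` (its complement has the two end-components as sides), which is
what the normal field `ν 0` of the interface needs.  WHY TRUE (the classical forward chain; only (iii) is in the tree): (i) short-time
existence, uniqueness and smoothness up to `t = 0` of the flow of a closed embedded hypersurface of the complete manifold `N` of
bounded geometry, with normal velocity and prescribed initial parametrisation (quasilinear strictly parabolic after writing `M_t` as
a normal graph over `ι`; the tree PROVES the abstract engine `Literature.Analysis.PDE.quasilinear_shortTime_existence`; Huisken 1986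
§§3–4, Mantegazza 2011 Thm. 1.5.1), the family extended smoothly to `t < 0` (Seeley 1964) so that it is smooth on an open set — the
interface constrains only `t ≥ 0`, and at `t = 0` the two-sided `t`-derivative of the extension is the one-sided one; (ii)
embeddedness is preserved while the flow is smooth (maximum principle, Mantegazza 2011 Prop. 2.2.7); (iii) Hamilton's monotonicity
in `N` (PROVED: `IsCylinderMCF.cylDensity_le`) keeps every typed density `≤ λ_cyl(range ι) < 1 + δ` at all centres, scales and times;
(iv) for `δ ≤ ε_White` White's local regularity theorem in the form of an a-priori curvature estimate up to the maximal time, fed by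
(iii) and the tree's small-scale Gaussian domination `SphericalCylinderInclusionDomination`, bounds `|A|` near any finite maximal
time; (v) the continuation criterion (Huisken 1984 Thm. 8.1; Mantegazza 2011 Prop. 2.4.x) then makes the flow immortal.
Load-bearing: thinness (a cross-section with a thin neck pinches in finite time), separation (pockets, above), compactness +
embeddedness (the interface).  TRUE and trivial for the slice (static flow, tree `isCylinderMCF_staticSlice`; slices separate).  Not a
printed theorem verbatim (the Euclidean literature has no closed thin hypersurfaces): (i), (ii), (v) are printed, (iii) is proved
here, and (iv) is printed for unforced Euclidean flows as an a-priori estimate up to the final time (Ecker 2004 Thm. 5.6) and for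
forced flows on open space-time sets (White 2005 Thm. 3.1/3.5 + §4) — the final-time a-priori form for the forced flow `N ⊂ ℝ⁶` is the
one statement a discharge must vend (or go through Brakke flows in `N`).  With the LANDED γ3
(`…Theorems.CylinderEntropySliceIsolation.stub_separationPersists`, p145458) and `stub_white2005` it gives the crux through the landed
`helper_sliceIsolationOfThinFlow` (p137301).  Crux-sized: `promote-stub` requested (c8), re-requested with THIS signature (c9).
[size XL] [cite: White2005, Thm. 3.5 and §4] [cite: Huisken1984, Thm. 8.1] -/
theorem stub_thinFlowImmortal :
    ∃ δ : ℝ, 0 < δ ∧ ∀ (M : Type) [TopologicalSpace M] [T2Space M] [SecondCountableTopology M]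
      [ChartedSpace (EuclideanSpace ℝ (Fin 4)) M] [IsManifold (𝓡 4) ∞ M] [CompactSpace M] [ConnectedSpace M]
      (ι : M → EuclideanSpace ℝ (Fin 6)), Manifold.IsSmoothEmbedding (𝓡 4) (𝓡 6) ∞ ι →
      (∀ x, ∑ i : Fin 5, ι x (Fin.castSucc i) ^ 2 = 1) →
      (∃ R : ℝ, ∀ a b : EuclideanSpace ℝ (Fin 6), ∑ i : Fin 5, a (Fin.castSucc i) ^ 2 = 1 →
        ∑ i : Fin 5, b (Fin.castSucc i) ^ 2 = 1 → a 5 ≤ -R → R ≤ b 5 →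
        ¬ JoinedIn ({z : EuclideanSpace ℝ (Fin 6) | ∑ i : Fin 5, z (Fin.castSucc i) ^ 2 = 1} \ Set.range ι) a b) →
      Literature.Geometry.Riemannian.SphericalCylinderEntropy.cylEntropy (Set.range ι) < ENNReal.ofReal (1 + δ) →
      ∃ (F : ℝ → M → EuclideanSpace ℝ (Fin 6)) (ν : ℝ → M → EuclideanSpace ℝ (Fin 6)),
        Summit.SmoothPoincare4.SmoothPoincare4.Cruxes.CylinderRungTwo.KillingFlux.IsCylinderMCF M F ν 0 ∧ F 0 = ι := by
  sorry

/-! Former STUB γ3 · END-SEPARATION PERSISTS ALONG A CYLINDER FLOW (chain γ; registered at reshape r10 by lead c8; size L,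
TOPOLOGICAL) — LANDED VERBATIM (lead c8, session 4, 2026-08-17T06:57Z) as
`Summit.SmoothPoincare4.SmoothPoincare4.Theorems.CylinderEntropySliceIsolation.stub_separationPersists`
(`Theorems/CylinderEntropySliceIsolationStubSeparationPersists.lean`, p145458; Aux1–8 p140698 p140920 p141510 p142490 p143076 p143105
p145126 p145168; ≈ 2650 lines; axioms = {propext, Classical.choice, Quot.sound}): along any `IsCylinderMCF M F ν T` of a compact
connected `M`, if `range (F T)` separates the two ends of `N` then every `range (F t)`, `t ≥ T`, does (continuous induction: the set of
separating times is closed — a path joining the ends off `F t (M)` misses the uniformly close nearby slices — and open to the right —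
push-offs of both signs, Jordan–Brouwer for `Φ(Σ) ⊂ ℝ⁵` via the tree's `not_isPreconnected_compl_of_homeomorph_closedManifold`, and a
push-off radius uniform in time by strict differentiability of the joint chart representative).  Used BY NAME in
`SliceIsolation_of_thinFlow` below (reshape r11); no longer a stub of this skeleton. -/

/-- STUB γ2 · NAMED CLASSICAL FACT (chain γ; reshape r10, lead c8): White's local regularity theorem for mean curvature flow, single-sheet
form for smooth flows of closed cross-sections of `N = S⁴ × ℝ ⊂ ℝ⁶` — the tree's EXISTING named fact
`Literature.Geometry.Riemannian.White2005_localRegularity_cylinderFlowSheet` (statement only; B. White, Ann. of Math. 161 (2005),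
Thm. 3.1 and §4; registered hypothesis-style in crux 7631's line as well).  Not a lemma to prove here; the closing theorem of chain γ
carries it by name. [cite: White2005, Thm. 3.1 and §4] -/
theorem stub_white2005 : Literature.Geometry.Riemannian.White2005_localRegularity_cylinderFlowSheet := by
  sorry

/-- Former STUB α · SLAB CONFINEMENT (chain α; promoted by lead gen 0; UNREGISTERED at reshape r10, lead c8, to keep the registered
stubs at the cap of 7 — chain α is redundant after β: same CMS debt): Hausdorff stability of the slice among low-entropy
cross-sections, kept as the readable hypothesis of `SliceIsolation_of_slab`. [size: item] -/
def SlabConfinementStatement : Prop :=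
    ∀ η : ℝ, 0 < η → ∃ ε : ℝ, 0 < ε ∧
      ∀ (M : Type) [TopologicalSpace M] [T2Space M] [SecondCountableTopology M]
        [ChartedSpace (EuclideanSpace ℝ (Fin 4)) M] [IsManifold (𝓡 4) ∞ M] [CompactSpace M]
        [ConnectedSpace M] (ι : M → EuclideanSpace ℝ (Fin 6)), Manifold.IsSmoothEmbedding (𝓡 4) (𝓡 6) ∞ ι →
        (∀ x, ∑ i : Fin 5, ι x (Fin.castSucc i) ^ 2 = 1) →
        (∃ R : ℝ, ∀ a b : EuclideanSpace ℝ (Fin 6), ∑ i : Fin 5, a (Fin.castSucc i) ^ 2 = 1 →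
          ∑ i : Fin 5, b (Fin.castSucc i) ^ 2 = 1 → a 5 ≤ -R → R ≤ b 5 →
          ¬ JoinedIn ({z : EuclideanSpace ℝ (Fin 6) | ∑ i : Fin 5, z (Fin.castSucc i) ^ 2 = 1} \ Set.range ι) a b) →
        cylEntropy (Set.range ι) ≤ ENNReal.ofReal (1 + ε) →
        ∃ t₀ : ℝ, ∀ z ∈ Set.range ι, |z 5 - t₀| ≤ η

/-- STUB β1 · SMALL-SCALE CERTIFICATE — LANDED p100253 (one atom + area atom, `T ≤ 10⁻⁵`): with `(ε, κ, c) = (1/25, 9/100, 1/20)` the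
tree's `near_exp_compare` / Cheeger–Yau (`CheegerYauZonalSphereFour_holds`) give the near region with the atom
`w = e^{4ε}(1+κ)²` at `(σ, τ) = (0, (1+κ)T)`, and the far region `Q > ε²` is below the area atom `c`
(`16 V (4πT)⁻² e^{-ε²/4T} ≤ c` for `eᵘ ≤ 2`, super-exponential decay for `eᵘ ≥ 2`); mass `≤ 1.45`. [size M] -/
theorem stub_certSmall :
    ∀ T : ℝ, 0 < T → T ≤ 1 / 100000 → ∃ σ τ w c : ℝ, 0 < τ ∧ 0 ≤ w ∧ 0 ≤ c ∧ w + c ≤ 147 / 100 ∧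
      ∀ u s : ℝ, -1 ≤ s → s ≤ 1 →
        (8 * Real.pi ^ 2 / 3) * ((4 * Real.pi * T) ^ 2)⁻¹ * Real.exp (4 * u) *
            Real.exp (-(Real.exp (2 * u) - 2 * Real.exp u * s + 1) / (4 * T)) ≤
          w * (zonal τ s * Real.exp (-(u - σ) ^ 2 / (4 * τ))) + c :=
  -- LANDED p100253 (worker, wave 1): `Theorems/CylinderEntropySliceIsolationStubCertSmall.lean`
  Summit.SmoothPoincare4.SmoothPoincare4.Theorems.CylinderEntropySliceIsolation.stub_certSmall

/-- STUB β2-A · MID-SCALE CERTIFICATES, decade `10⁻² ≤ T ≤ 10⁻¹` (reshape r8, lead c2; COMPUTATIONAL): for every such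
`T` a finite on-axis zonal certificate of mass `≤ 147/100`. Proof plan (lead c2): a kernel-sound COMPUTABLE interval checker
(`Cert.*`: dyadic rounding, `exp` enclosures, rational Gegenbauer recurrence + geometric tail / pole minorant for `zonal`,
`s`-monotonicity, exact `T`-envelope `sup_{T ∈ cell} T⁻² e^{-Q/4T}`, analytic `u`-tails, adaptive `(u, s)` bisection) proved sound
once and run by `native_decide` (`--computational`) on LP certificates per `T`-cell with atoms at `τ_j = -log(q_j)/2`, `q_j ∈ ℚ`.
[size: computational] -/
theorem stub_certMidA :
    ∀ T : ℝ, 1 / 100 ≤ T → T ≤ 1 / 10 →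
      ∃ (n : ℕ) (σ τ w : Fin n → ℝ) (c : ℝ), (∀ j, 0 < τ j) ∧ (∀ j, 0 ≤ w j) ∧ 0 ≤ c ∧ (∑ j, w j) + c ≤ 147 / 100 ∧
        ∀ u s : ℝ, -1 ≤ s → s ≤ 1 →
          (8 * Real.pi ^ 2 / 3) * ((4 * Real.pi * T) ^ 2)⁻¹ * Real.exp (4 * u) *
              Real.exp (-(Real.exp (2 * u) - 2 * Real.exp u * s + 1) / (4 * T)) ≤
            (∑ j, w j * (zonal (τ j) s * Real.exp (-(u - σ j) ^ 2 / (4 * τ j)))) + c :=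
  -- LANDED COMPUTATIONALLY (lead c2): `Theorems/CylinderEntropySliceIsolationStubCertMidA.lean` (LP certificates accepted by
  -- the kernel-sound computable checker `Cert.checkCover`, evaluated by `native_decide`, `--computational`). Its axiom closure
  -- contains the `native_decide` auxiliary axioms `certCellsA*_ok._native.native_decide.ax_1_1`, which are OUTSIDE the closing
  -- whitelist {propext, Classical.choice, Quot.sound} (`ledger skeleton check`: skeleton.axiom) — so for the crux-closing
  -- composition this stub stays OPEN until a kernel-clean proof (or a gate ruling admitting computational closes); lead c3.
  by sorry

/-- STUB β2-B · MID-SCALE CERTIFICATES, decade `10⁻¹ ≤ T ≤ 1` (reshape r8, lead c2; COMPUTATIONAL; same plan as β2-A, series-mode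
atoms `K ≤ 70`). [size: computational] -/
theorem stub_certMidB :
    ∀ T : ℝ, 1 / 10 ≤ T → T ≤ 1 →
      ∃ (n : ℕ) (σ τ w : Fin n → ℝ) (c : ℝ), (∀ j, 0 < τ j) ∧ (∀ j, 0 ≤ w j) ∧ 0 ≤ c ∧ (∑ j, w j) + c ≤ 147 / 100 ∧
        ∀ u s : ℝ, -1 ≤ s → s ≤ 1 →
          (8 * Real.pi ^ 2 / 3) * ((4 * Real.pi * T) ^ 2)⁻¹ * Real.exp (4 * u) *
              Real.exp (-(Real.exp (2 * u) - 2 * Real.exp u * s + 1) / (4 * T)) ≤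
            (∑ j, w j * (zonal (τ j) s * Real.exp (-(u - σ j) ^ 2 / (4 * τ j)))) + c :=
  -- LANDED COMPUTATIONALLY (lead c2): `Theorems/CylinderEntropySliceIsolationStubCertMidB.lean` (LP certificates accepted by
  -- the kernel-sound computable checker `Cert.checkCover`, evaluated by `native_decide`, `--computational`). Its axiom closure
  -- contains the `native_decide` auxiliary axioms `certCellsB*_ok._native.native_decide.ax_1_1`, which are OUTSIDE the closing
  -- whitelist {propext, Classical.choice, Quot.sound} (`ledger skeleton check`: skeleton.axiom) — so for the crux-closing
  -- composition this stub stays OPEN until a kernel-clean proof (or a gate ruling admitting computational closes); lead c3.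
  by sorry

/-- STUB β2-C · MID-SCALE CERTIFICATES, decade `1 ≤ T ≤ 10` (reshape r8, lead c2; COMPUTATIONAL; the tightest decade: LP optimum
`≈ 1.41 … 1.4406` against the bound `147/100`, narrow cells). [size: computational] -/
theorem stub_certMidC :
    ∀ T : ℝ, 1 ≤ T → T ≤ 10 →
      ∃ (n : ℕ) (σ τ w : Fin n → ℝ) (c : ℝ), (∀ j, 0 < τ j) ∧ (∀ j, 0 ≤ w j) ∧ 0 ≤ c ∧ (∑ j, w j) + c ≤ 147 / 100 ∧
        ∀ u s : ℝ, -1 ≤ s → s ≤ 1 →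
          (8 * Real.pi ^ 2 / 3) * ((4 * Real.pi * T) ^ 2)⁻¹ * Real.exp (4 * u) *
              Real.exp (-(Real.exp (2 * u) - 2 * Real.exp u * s + 1) / (4 * T)) ≤
            (∑ j, w j * (zonal (τ j) s * Real.exp (-(u - σ j) ^ 2 / (4 * τ j)))) + c :=
  -- LANDED COMPUTATIONALLY (lead c2): `Theorems/CylinderEntropySliceIsolationStubCertMidC.lean` (LP certificates accepted by
  -- the kernel-sound computable checker `Cert.checkCover`, evaluated by `native_decide`, `--computational`). Its axiom closure
  -- contains the `native_decide` auxiliary axioms `certCellsC*_ok._native.native_decide.ax_1_1`, which are OUTSIDE the closing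
  -- whitelist {propext, Classical.choice, Quot.sound} (`ledger skeleton check`: skeleton.axiom) — so for the crux-closing
  -- composition this stub stays OPEN until a kernel-clean proof (or a gate ruling admitting computational closes); lead c3.
  by sorry

/-- The three decade stubs give the mid-scale certificates on `[10⁻², 10]` (the former single stub `stub_certMid`, reshape r8). -/
theorem certMid_of_decades :
    ∀ T : ℝ, 1 / 100 ≤ T → T ≤ 10 →
      ∃ (n : ℕ) (σ τ w : Fin n → ℝ) (c : ℝ), (∀ j, 0 < τ j) ∧ (∀ j, 0 ≤ w j) ∧ 0 ≤ c ∧ (∑ j, w j) + c ≤ 147 / 100 ∧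
        ∀ u s : ℝ, -1 ≤ s → s ≤ 1 →
          (8 * Real.pi ^ 2 / 3) * ((4 * Real.pi * T) ^ 2)⁻¹ * Real.exp (4 * u) *
              Real.exp (-(Real.exp (2 * u) - 2 * Real.exp u * s + 1) / (4 * T)) ≤
            (∑ j, w j * (zonal (τ j) s * Real.exp (-(u - σ j) ^ 2 / (4 * τ j)))) + c := by
  intro T h1 h2
  rcases le_or_gt T (1 / 10) with hA | hA
  · exact stub_certMidA T h1 hA
  rcases le_or_gt T 1 with hB | hB
  · exact stub_certMidB T hA.le hB
  · exact stub_certMidC T hB.le h2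

/-- STUB β2a · LOW-MID CERTIFICATE — LANDED p103865 (`10⁻⁵ ≤ T ≤ 2·10⁻⁴`, ONE atom with SHIFTED centre `σ = 8τ`,
`τ = (59/50)T`, `w = (59/50)²e^{(472/25)T}`, `c = 1/50`; the linear terms of the exponent inequality cancel under the shift). -/
theorem stub_certMidLow :
    ∀ T : ℝ, 1 / 100000 ≤ T → T ≤ 1 / 5000 → ∃ σ τ w c : ℝ, 0 < τ ∧ 0 ≤ w ∧ 0 ≤ c ∧ w + c ≤ 147 / 100 ∧
      ∀ u s : ℝ, -1 ≤ s → s ≤ 1 →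
        (8 * Real.pi ^ 2 / 3) * ((4 * Real.pi * T) ^ 2)⁻¹ * Real.exp (4 * u) *
            Real.exp (-(Real.exp (2 * u) - 2 * Real.exp u * s + 1) / (4 * T)) ≤
          w * (zonal τ s * Real.exp (-(u - σ) ^ 2 / (4 * τ))) + c :=
  Summit.SmoothPoincare4.SmoothPoincare4.Theorems.CylinderEntropySliceIsolation.stub_certMidLow

/-- STUB β2b · MID CERTIFICATE — LANDED p106293 (`2·10⁻⁴ ≤ T ≤ 10⁻³`, TWO atoms: a shifted main atom covering `eᵘ ≥ 8/9` and a
cheap lower-flank atom centred at `log(8/9)`; mass `1.389` at `T = 10⁻³`). -/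
theorem stub_certMidLow2 :
    ∀ T : ℝ, 1 / 5000 ≤ T → T ≤ 1 / 1000 → ∃ σ₁ τ₁ w₁ σ₂ τ₂ w₂ c : ℝ, 0 < τ₁ ∧ 0 < τ₂ ∧ 0 ≤ w₁ ∧ 0 ≤ w₂ ∧ 0 ≤ c ∧
      w₁ + w₂ + c ≤ 147 / 100 ∧
      ∀ u s : ℝ, -1 ≤ s → s ≤ 1 →
        (8 * Real.pi ^ 2 / 3) * ((4 * Real.pi * T) ^ 2)⁻¹ * Real.exp (4 * u) *
            Real.exp (-(Real.exp (2 * u) - 2 * Real.exp u * s + 1) / (4 * T)) ≤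
          w₁ * (zonal τ₁ s * Real.exp (-(u - σ₁) ^ 2 / (4 * τ₁))) +
            w₂ * (zonal τ₂ s * Real.exp (-(u - σ₂) ^ 2 / (4 * τ₂))) + c :=
  Summit.SmoothPoincare4.SmoothPoincare4.Theorems.CylinderEntropySliceIsolation.stub_certMidLow2

/-- STUB β2c · HIGH CERTIFICATE — LANDED p111171 (`100 ≤ T ≤ 4·10⁴`, flat + ONE dipole atom, symbolic and uniform in
`b = √(2/T)`: `σ = ½log(8T)`, `τ = log 2`, `w = Λ₄(161/50)b`, `c = Λ₄(509/500 − (161/50)b)`, mass `(509/500)Λ₄ = 1.4696`). -/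
theorem stub_certHigh :
    ∀ T : ℝ, 100 ≤ T → T ≤ 40000 → ∃ σ τ w c : ℝ, 0 < τ ∧ 0 ≤ w ∧ 0 ≤ c ∧ w + c ≤ 147 / 100 ∧
      ∀ u s : ℝ, -1 ≤ s → s ≤ 1 →
        (8 * Real.pi ^ 2 / 3) * ((4 * Real.pi * T) ^ 2)⁻¹ * Real.exp (4 * u) *
            Real.exp (-(Real.exp (2 * u) - 2 * Real.exp u * s + 1) / (4 * T)) ≤
          w * (zonal τ s * Real.exp (-(u - σ) ^ 2 / (4 * τ))) + c :=
  Summit.SmoothPoincare4.SmoothPoincare4.Theorems.CylinderEntropySliceIsolation.stub_certHigh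

/-- STUB β2e · MID CERTIFICATE III — LANDED p124752 (`10⁻³ ≤ T ≤ 10⁻²`, THREE atoms; softmax/Gibbs blending rule `certMidLow3_rule`,
4 sub-ranges, 12 files). -/
theorem stub_certMidLow3 :
    ∀ T : ℝ, 1 / 1000 ≤ T → T ≤ 1 / 100 → ∃ σ₁ τ₁ w₁ σ₂ τ₂ w₂ σ₃ τ₃ w₃ c : ℝ, 0 < τ₁ ∧ 0 < τ₂ ∧ 0 < τ₃ ∧ 0 ≤ w₁ ∧ 0 ≤ w₂ ∧ 0 ≤ w₃ ∧ 0 ≤ c ∧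
      w₁ + w₂ + w₃ + c ≤ 147 / 100 ∧
      ∀ u s : ℝ, -1 ≤ s → s ≤ 1 →
        (8 * Real.pi ^ 2 / 3) * ((4 * Real.pi * T) ^ 2)⁻¹ * Real.exp (4 * u) *
            Real.exp (-(Real.exp (2 * u) - 2 * Real.exp u * s + 1) / (4 * T)) ≤
          w₁ * (zonal τ₁ s * Real.exp (-(u - σ₁) ^ 2 / (4 * τ₁))) + w₂ * (zonal τ₂ s * Real.exp (-(u - σ₂) ^ 2 / (4 * τ₂))) +
            w₃ * (zonal τ₃ s * Real.exp (-(u - σ₃) ^ 2 / (4 * τ₃))) + c :=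
  Summit.SmoothPoincare4.SmoothPoincare4.Theorems.CylinderEntropySliceIsolation.stub_certMidLow3

/-- STUB β2d · HIGH CERTIFICATE II — LANDED p118386 (`10 ≤ T ≤ 100`, flat + TWO dipole atoms `τ = (log 2)/2, log 2` at `σ = ½log(8T)`, weights
affine in `b = √(2/T)`, tensor-Bernstein cells; helpers p114910/p115647/p117721). -/
theorem stub_certHigh2 :
    ∀ T : ℝ, 10 ≤ T → T ≤ 100 → ∃ σ₁ τ₁ w₁ σ₂ τ₂ w₂ c : ℝ, 0 < τ₁ ∧ 0 < τ₂ ∧ 0 ≤ w₁ ∧ 0 ≤ w₂ ∧ 0 ≤ c ∧ w₁ + w₂ + c ≤ 147 / 100 ∧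
      ∀ u s : ℝ, -1 ≤ s → s ≤ 1 →
        (8 * Real.pi ^ 2 / 3) * ((4 * Real.pi * T) ^ 2)⁻¹ * Real.exp (4 * u) *
            Real.exp (-(Real.exp (2 * u) - 2 * Real.exp u * s + 1) / (4 * T)) ≤
          w₁ * (zonal τ₁ s * Real.exp (-(u - σ₁) ^ 2 / (4 * τ₁))) + w₂ * (zonal τ₂ s * Real.exp (-(u - σ₂) ^ 2 / (4 * τ₂))) + c :=
  Summit.SmoothPoincare4.SmoothPoincare4.Theorems.CylinderEntropySliceIsolation.stub_certHigh2

/-- STUB β3 · LARGE-SCALE CERTIFICATE — LANDED p98979 (area atom alone, `T ≥ 4·10⁴`): `s ≤ 1` gives the radial profile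
`V(4πT)⁻² e^{4u - (eᵘ-1)²/4T}`, whose supremum is `Λ₄ (1 + r/8T)² e^{(r-1)/4T}` at `r(r-1) = 8T`
(`Λ₄ = 32/(3e²) = 1.4436`), `≤ 1.454 ≤ 147/100` for `T ≥ 4·10⁴`. [size S–M] -/
theorem stub_certLarge :
    ∀ T : ℝ, 40000 ≤ T → ∀ u s : ℝ, -1 ≤ s → s ≤ 1 →
      (8 * Real.pi ^ 2 / 3) * ((4 * Real.pi * T) ^ 2)⁻¹ * Real.exp (4 * u) *
          Real.exp (-(Real.exp (2 * u) - 2 * Real.exp u * s + 1) / (4 * T)) ≤ 147 / 100 :=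
  -- LANDED p98979 (worker, wave 1): `Theorems/CylinderEntropySliceIsolationStubCertLarge.lean`
  Summit.SmoothPoincare4.SmoothPoincare4.Theorems.CylinderEntropySliceIsolation.stub_certLarge

/-- STUB β4 · DOMINATION BOOKKEEPING — LANDED p101732 (pure measure theory on the fixed pair `(N, ℝ⁵)`): certificates of mass `≤ C` at
every normalised scale, with `C ≥ λ(S⁴) = 32/(3e²)` for the centre `y = 0`, give `λ_E(Φ A) ≤ C λ_cyl(A)` for every
bounded measurable `A ⊆ N` (layer-cake pushforward, certificate at `T = t/‖y‖²` with centres `(ŷ, log‖y‖ + σ_j)`,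
`F̂ ≤ λ_cyl`, `μH⁴(A)/μH⁴(S⁴) ≤ λ_cyl`, `y = 0` by `gaussianArea_zero_conformal_le`). [size M–L] -/
theorem stub_dominationBookkeeping :
    ∀ C : ℝ, 32 / (3 * Real.exp 1 ^ 2) ≤ C →
      (∀ T : ℝ, 0 < T →
        ∃ (n : ℕ) (σ τ w : Fin n → ℝ) (c : ℝ), (∀ j, 0 < τ j) ∧ (∀ j, 0 ≤ w j) ∧ 0 ≤ c ∧ (∑ j, w j) + c ≤ C ∧
          ∀ u s : ℝ, -1 ≤ s → s ≤ 1 →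
            (8 * Real.pi ^ 2 / 3) * ((4 * Real.pi * T) ^ 2)⁻¹ * Real.exp (4 * u) *
                Real.exp (-(Real.exp (2 * u) - 2 * Real.exp u * s + 1) / (4 * T)) ≤
              (∑ j, w j * (zonal (τ j) s * Real.exp (-(u - σ j) ^ 2 / (4 * τ j)))) + c) →
      ∀ A : Set (EuclideanSpace ℝ (Fin 6)),
        A ⊆ {z : EuclideanSpace ℝ (Fin 6) | ∑ i : Fin 5, z (Fin.castSucc i) ^ 2 = 1} → MeasurableSet A →
        (∃ B : ℝ, ∀ z ∈ A, |z 5| ≤ B) →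
          gaussianEntropy 4
            ((fun z : EuclideanSpace ℝ (Fin 6) =>
              (WithLp.toLp 2 (fun i : Fin 5 => Real.exp (z 5) * z (Fin.castSucc i)) : EuclideanSpace ℝ (Fin 5))) '' A) ≤
            ENNReal.ofReal C * cylEntropy A :=
  -- LANDED p101732 (worker, wave 1): `Theorems/CylinderEntropySliceIsolationStubDominationBookkeeping.lean`
  -- (integration step = the tree's `SphericalCylinderConformal.gaussianArea_conformal_le_of_certificate`, other seat)
  Summit.SmoothPoincare4.SmoothPoincare4.Theorems.CylinderEntropySliceIsolation.stub_dominationBookkeeping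

/-! ### The registered statements are the readable ones (definitional bridges, kernel-checked) -/

/-- The former STUB β2 (`[10⁻², 10]`, now `certMid_of_decades`) is `∀ T ∈ [10⁻², 10], CertAt (147/100) T` up to unfolding
`CertAt`, `pulled`. -/
theorem certMid_iff_stub :
    (∀ T : ℝ, 1 / 100 ≤ T → T ≤ 10 → CertAt (147 / 100) T) ↔ type_of% certMid_of_decades := Iff.rfl

/-- Registered STUB β4 is `∀ C ≥ Λ₄, (∀ T > 0, CertAt C T) → EntropyDominationBounded C` up to unfolding. -/
theorem dominationBookkeeping_iff_stub :
    (∀ C : ℝ, 32 / (3 * Real.exp 1 ^ 2) ≤ C → (∀ T : ℝ, 0 < T → CertAt C T) → EntropyDominationBounded C) ↔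
      type_of% stub_dominationBookkeeping := Iff.rfl

/-! ## Composition (sorry-free) -/

/-- `Λ₄ = 32/(3e²) ≤ 147/100`. -/
theorem sphereEntropy_le_C : 32 / (3 * Real.exp 1 ^ 2) ≤ 147 / 100 := by
  have he1 : (2.7182818283 : ℝ) < Real.exp 1 := Real.exp_one_gt_d9
  have he0 : 0 < Real.exp 1 := Real.exp_pos 1
  rw [div_le_div_iff₀ (by positivity) (by norm_num)]
  nlinarith [mul_pos he0 he0]

/-- `0 < 4/(1.47 e) - 1` and `1.47 (1 + (4/(1.47e) - 1)) = 4/e`: the explicit `ε` of chain β. -/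
theorem epsilon_pos : 0 < 4 / (147 / 100 * Real.exp 1) - 1 := by
  have he2 : Real.exp 1 < 2.7182818286 := Real.exp_one_lt_d9
  have he0 : 0 < Real.exp 1 := Real.exp_pos 1
  rw [sub_pos, lt_div_iff₀ (by positivity)]
  nlinarith

/-- Packaging a ONE-atom certificate (`w · (𝔥(τ,s) Gaussian) + c`) as a `CertAt` (`n = 1`). -/
theorem certAt_of_one {T σ τ w c : ℝ} (hτ : 0 < τ) (hw : 0 ≤ w) (hc : 0 ≤ c) (hmass : w + c ≤ 147 / 100)
    (hpt : ∀ u s : ℝ, -1 ≤ s → s ≤ 1 →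
      (8 * Real.pi ^ 2 / 3) * ((4 * Real.pi * T) ^ 2)⁻¹ * Real.exp (4 * u) *
          Real.exp (-(Real.exp (2 * u) - 2 * Real.exp u * s + 1) / (4 * T)) ≤
        w * (zonal τ s * Real.exp (-(u - σ) ^ 2 / (4 * τ))) + c) :
    CertAt (147 / 100) T := by
  refine ⟨1, fun _ => σ, fun _ => τ, fun _ => w, c, fun _ => hτ, fun _ => hw, hc, by simpa using hmass, ?_⟩
  intro u s hs1 hs2
  simpa [pulled] using hpt u s hs1 hs2

/-- Certificates at EVERY normalised scale from the eight regime stubs (ALL LANDED; `stub_certMid` as its three decades), packaging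
`n = 1, 1, 2, 3, n, 2, 1, 0`. -/
theorem certAll (hM : type_of% certMid_of_decades) : ∀ T : ℝ, 0 < T → CertAt (147 / 100) T := by
  intro T hT
  rcases le_or_gt T (1 / 100000) with h1 | h1
  · obtain ⟨σ, τ, w, c, hτ, hw, hc, hmass, hpt⟩ := stub_certSmall T hT h1
    exact certAt_of_one hτ hw hc hmass hpt
  rcases le_or_gt T (1 / 5000) with h2 | h2
  · obtain ⟨σ, τ, w, c, hτ, hw, hc, hmass, hpt⟩ := stub_certMidLow T h1.le h2
    exact certAt_of_one hτ hw hc hmass hpt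
  rcases le_or_gt T (1 / 1000) with h3 | h3
  · obtain ⟨σ₁, τ₁, w₁, σ₂, τ₂, w₂, c, hτ₁, hτ₂, hw₁, hw₂, hc, hmass, hpt⟩ := stub_certMidLow2 T h2.le h3
    refine ⟨2, ![σ₁, σ₂], ![τ₁, τ₂], ![w₁, w₂], c, ?_, ?_, hc, ?_, ?_⟩
    · intro j; fin_cases j <;> simpa
    · intro j; fin_cases j <;> simpa
    · simpa [Fin.sum_univ_two, add_assoc] using hmass
    · intro u s hs1 hs2
      simpa [pulled, Fin.sum_univ_two, add_assoc] using hpt u s hs1 hs2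
  rcases le_or_gt T (1 / 100) with h3b | h3b
  · obtain ⟨σ₁, τ₁, w₁, σ₂, τ₂, w₂, σ₃, τ₃, w₃, c, hτ₁, hτ₂, hτ₃, hw₁, hw₂, hw₃, hc, hmass, hpt⟩ :=
      stub_certMidLow3 T h3.le h3b
    refine ⟨3, ![σ₁, σ₂, σ₃], ![τ₁, τ₂, τ₃], ![w₁, w₂, w₃], c, ?_, ?_, hc, ?_, ?_⟩
    · intro j; fin_cases j <;> simpa
    · intro j; fin_cases j <;> simpa
    · simpa [Fin.sum_univ_three, add_assoc] using hmass
    · intro u s hs1 hs2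
      simpa [pulled, Fin.sum_univ_three, add_assoc] using hpt u s hs1 hs2
  rcases le_or_gt T 10 with h4a | h4a
  · exact hM T h3b.le h4a
  rcases le_or_gt T 100 with h4 | h4
  · obtain ⟨σ₁, τ₁, w₁, σ₂, τ₂, w₂, c, hτ₁, hτ₂, hw₁, hw₂, hc, hmass, hpt⟩ := stub_certHigh2 T h4a.le h4
    refine ⟨2, ![σ₁, σ₂], ![τ₁, τ₂], ![w₁, w₂], c, ?_, ?_, hc, ?_, ?_⟩
    · intro j; fin_cases j <;> simpa
    · intro j; fin_cases j <;> simpa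
    · simpa [Fin.sum_univ_two, add_assoc] using hmass
    · intro u s hs1 hs2
      simpa [pulled, Fin.sum_univ_two, add_assoc] using hpt u s hs1 hs2
  rcases le_or_gt T 40000 with h5 | h5
  · obtain ⟨σ, τ, w, c, hτ, hw, hc, hmass, hpt⟩ := stub_certHigh T h4.le h5
    exact certAt_of_one hτ hw hc hmass hpt
  · refine ⟨0, Fin.elim0, Fin.elim0, Fin.elim0, 147 / 100, fun j => j.elim0, fun j => j.elim0, by norm_num,
      by simp, ?_⟩
    intro u s hs1 hs2
    simpa [pulled] using stub_certLarge T h5.le u s hs1 hs2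

/-- Chain β, analytic half: `λ_E(Φ A) ≤ 1.47 λ_cyl(A)` for bounded measurable `A ⊆ N`, from the β stubs (formerly only `stub_certMid`
open). -/
theorem entropyDominationBounded (hM : type_of% certMid_of_decades) : EntropyDominationBounded (147 / 100) :=
  (dominationBookkeeping_iff_stub.2 stub_dominationBookkeeping) (147 / 100) sphereEntropy_le_C (certAll hM)

/-- The recognition step: instances from `M ≃ₕ S⁴` (tree), `Φ ∘ ι` a smooth embedding (LANDED stub 1), and CMS Cor. 1.5 (b) alone. -/
theorem diffeomorph_of_conformal_entropy_le
    (hb : ChodoshMantoulidisSchulze2025_cor15b_four)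
    (M : Type) [TopologicalSpace M] [T2Space M] [SecondCountableTopology M]
    [ChartedSpace (EuclideanSpace ℝ (Fin 4)) M] [IsManifold (𝓡 4) ∞ M]
    (e : M ≃ₕ Metric.sphere (0 : E5) 1) (ι : M → E6)
    (hι : Manifold.IsSmoothEmbedding (𝓡 4) (𝓡 6) ∞ ι) (hN : ∀ x, ∑ i : Fin 5, ι x (Fin.castSucc i) ^ 2 = 1)
    (hbound : gaussianEntropy 4 (conformalMap '' Set.range ι) ≤ gaussianEntropy 4 (shrinkingCylinder 4 2)) :
    Nonempty (M ≃ₘ⟮𝓡 4, 𝓡 4⟯ Metric.sphere (0 : E5) 1) := by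
  haveI : CompactSpace M :=
    Literature.Topology.FourManifolds.compactSpace_of_homotopyEquiv_sphere_four_holds M e
  haveI : PathConnectedSpace M := by
    haveI := Literature.Topology.FourManifolds.pathConnectedSpace_sphere_four
    exact Literature.Topology.FourManifolds.pathConnectedSpace_of_homotopyEquiv e
  have hsc : SimplyConnectedSpace M :=
    Literature.Topology.FourManifolds.simplyConnectedSpace_of_homotopyEquiv_sphere_four
      Literature.Topology.FourManifolds.simplyConnectedSpace_sphere_four_holds M e
  have hemb : Manifold.IsSmoothEmbedding (𝓡 4) (𝓡 5) ∞ (conformalMap ∘ ι) :=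
    Summit.SmoothPoincare4.SmoothPoincare4.Theorems.CylinderEntropySliceIsolation.stub_conformalEmbedding M ι hι hN
  refine hb M hsc _ hemb ?_
  rwa [Set.range_comp]

/-- **Chain β composition (kernel-checked; no sorry in this proof): all-scales domination with a constant `C` with
`0 < C` and `C < 4/e`, together with CMS Cor. 1.5 (b), gives the crux with `ε = 4/(Ce) - 1`.** -/
theorem sliceIsolation_of_dominationBounded (hb : ChodoshMantoulidisSchulze2025_cor15b_four)
    {C : ℝ} (hC0 : 0 < C) (hC : C < 4 / Real.exp 1) (hdom : EntropyDominationBounded C) : SliceIsolation := by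
  have he0 : 0 < Real.exp 1 := Real.exp_pos 1
  set ε : ℝ := 4 / (C * Real.exp 1) - 1 with hε
  have hεpos : 0 < ε := by
    rw [hε, sub_pos, lt_div_iff₀ (by positivity)]
    rw [lt_div_iff₀ he0] at hC
    linarith
  have hCε : C * (1 + ε) = 4 / Real.exp 1 := by
    rw [hε]; field_simp; ring
  refine ⟨ε, hεpos, ?_⟩
  intro M _ _ _ _ _ e ι hι hN hsep hent
  haveI : CompactSpace M :=
    Literature.Topology.FourManifolds.compactSpace_of_homotopyEquiv_sphere_four_holds M e
  set A : Set E6 := Set.range ι with hA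
  have hent' : cylEntropy A < ENNReal.ofReal (1 + ε) := hent
  have hAN : A ⊆ cylN := by
    rintro _ ⟨x, rfl⟩
    exact hN x
  have hcpt : IsCompact A := isCompact_range hι.isEmbedding.continuous
  have hAm : MeasurableSet A := hcpt.isClosed.measurableSet
  have hAb : ∃ B : ℝ, ∀ z ∈ A, |z 5| ≤ B := by
    obtain ⟨B, hB⟩ := hcpt.exists_bound_of_continuousOn
      ((EuclideanSpace.proj (5 : Fin 6)).continuous.continuousOn)
    exact ⟨B, fun z hz => by simpa [Real.norm_eq_abs] using hB z hz⟩
  have hbound : gaussianEntropy 4 (conformalMap '' A) ≤ gaussianEntropy 4 (shrinkingCylinder 4 2) := by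
    calc gaussianEntropy 4 (conformalMap '' A) ≤ ENNReal.ofReal C * cylEntropy A := hdom A hAN hAm hAb
      _ ≤ ENNReal.ofReal C * ENNReal.ofReal (1 + ε) := by gcongr
      _ = ENNReal.ofReal (4 / Real.exp 1) := by
          rw [← ENNReal.ofReal_mul hC0.le, hCε]
      _ = gaussianEntropy 4 (shrinkingCylinder 4 2) := gaussianEntropy_shrinkingCylinder_four_two.symm
  exact diffeomorph_of_conformal_entropy_le hb M e ι hι hN hbound

/-- **The skeleton concludes the crux BY NAME (chain β).** `CylinderEntropy.SliceIsolation` (stmt-SmoothPoincare4-7632) from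
the registered stubs: STUB 0 (CMS Cor. 1.5 (b), by name — the only open one) and the β stubs (all landed). -/
theorem SliceIsolation_of : SliceIsolation :=
  sliceIsolation_of_dominationBounded stub_cor15bFour (C := 147 / 100) (by norm_num)
    (by
      have he2 : Real.exp 1 < 2.7182818286 := Real.exp_one_lt_d9
      rw [lt_div_iff₀ (Real.exp_pos 1)]
      nlinarith)
    (entropyDominationBounded certMid_of_decades)

/-- **The skeleton concludes the crux BY NAME (chain γ; reshape r10 of lead c8, r11/r12 of lead c9).** `CylinderEntropy.SliceIsolation`
from the two registered stubs of chain γ — immortality of thin SEPARATING cross-section flows (γ1, re-cut r12) and White's 2005 local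
regularity theorem (γ2, named fact) — and the LANDED γ3 (persistence of end-separation along the flow,
`…Theorems.CylinderEntropySliceIsolation.stub_separationPersists`, p145458, used by name).  The proof is the one of the LANDED
kernel-clean helper `Summit.SmoothPoincare4.SmoothPoincare4.Theorems.CylinderEntropySliceIsolation.helper_sliceIsolationOfThinFlow`
(`Theorems/CylinderEntropySliceIsolationOfThinFlow.lean`, p137301; whitelist axioms, no certificates), inlined over the stubs: entropy is
non-increasing along the flow (Hamilton, PROVED `IsCylinderMCF.cylEntropy_range_le_of_le`), White + the landed tilt gap make the normal
nowhere horizontal at `t = 1`, the shadow is a one-sheeted immersion (`stub_oneSheet`), a graphical cross-section is `S⁴`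
(`stub_graphicalIsSphere`); `ε = min(δ, ε_gap)`.  The crux's separation hypothesis `hsep` feeds γ1 (r12) and γ3 at `t = 0`. -/
theorem SliceIsolation_of_thinFlow : SliceIsolation := by
  obtain ⟨δ, hδ, hthin⟩ := stub_thinFlowImmortal
  -- VERTICAL GAP (landed chain of crux 7631 over the White fact): the universal `ε_gap` of the graphical regime
  obtain ⟨ε, hε, hgap⟩ := Summit.SmoothPoincare4.SmoothPoincare4.Cruxes.CylinderRungTwo.KillingFlux.stub_tiltGap
    (Summit.SmoothPoincare4.SmoothPoincare4.Cruxes.CylinderRungTwo.KillingFlux.helper_epsilonRegularityOfWhite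
      (Summit.SmoothPoincare4.SmoothPoincare4.Cruxes.CylinderRungTwo.KillingFlux.helper_whiteSheetOfFact stub_white2005))
  refine ⟨min δ ε, lt_min hδ hε, ?_⟩
  intro M _ _ _ _ _ e ι hι hN hsep hent
  -- instances from `M ≃ₕ S⁴` (PROVED in the tree)
  haveI : CompactSpace M :=
    Literature.Topology.FourManifolds.compactSpace_of_homotopyEquiv_sphere_four_holds M e
  haveI : PathConnectedSpace M := by
    haveI := Literature.Topology.FourManifolds.pathConnectedSpace_sphere_four
    exact Literature.Topology.FourManifolds.pathConnectedSpace_of_homotopyEquiv e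
  -- the typed entropy hypothesis, read in the two thresholds `δ` and `ε`
  have hent' : cylEntropy (Set.range ι) < ENNReal.ofReal (1 + min δ ε) := hent
  have hentδ : cylEntropy (Set.range ι) < ENNReal.ofReal (1 + δ) :=
    lt_of_lt_of_le hent' (ENNReal.ofReal_le_ofReal (by linarith [min_le_left δ ε]))
  have hentε : cylEntropy (Set.range ι) < ENNReal.ofReal (1 + ε) :=
    lt_of_lt_of_le hent' (ENNReal.ofReal_le_ofReal (by linarith [min_le_right δ ε]))
  -- γ1 (r12: fed with the crux's separation hypothesis): the immortal smooth flow of cross-section embeddings of `M` starting at `ι`;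
  -- γ3 (LANDED, by name): its slices separate the ends
  obtain ⟨F, ν, hflow, hF0⟩ := hthin M ι hι hN hsep hentδ
  have hsep0 : Summit.SmoothPoincare4.SmoothPoincare4.Cruxes.CylinderRungTwo.KillingFlux.SeparatesEnds (Set.range (F 0)) := by
    rw [hF0]; exact hsep
  have hsepF :=
    Summit.SmoothPoincare4.SmoothPoincare4.Theorems.CylinderEntropySliceIsolation.stub_separationPersists M F ν 0 hflow hsep0
  -- thin along the flow (Hamilton monotonicity, PROVED)
  have hthinF : ∀ s : ℝ, 0 ≤ s → cylEntropy (Set.range (F s)) < ENNReal.ofReal (1 + ε) := fun s hs =>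
    lt_of_le_of_lt (hflow.cylEntropy_range_le_of_le le_rfl hs) (by rw [hF0]; exact hentε)
  -- after one unit of `(1+ε)`-thin flow the normal is nowhere horizontal, so the shadow is an immersion
  have h01 : (0 : ℝ) ≤ 1 := zero_le_one
  have himm : ∀ x : M, Function.Injective (mfderiv (𝓡 4) (𝓡 5)
      ((Literature.Geometry.Riemannian.SphericalCylinderEntropy.truncL : E6 → E5) ∘ F 1) x) := by
    intro x
    have hsm : ContMDiff (𝓡 4) (𝓡 6) ∞ (F 1) := (hflow.isSmoothEmbedding _ h01).contMDiff
    refine Summit.SmoothPoincare4.SmoothPoincare4.Cruxes.CylinderRungTwo.KillingFlux.Reduction.injective_mfderiv_truncL_comp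
      ((hsm x).mdifferentiableAt (by simp)) ((hflow.isSpacelikeImmersion _ h01).injective_mfderiv x)
      (hflow.isUnitNormal _ h01).1 ?_
    exact hgap M F ν 0 hflow 1 (by norm_num)
      (fun s hs => hsepF s (by linarith [hs.1]))
      (fun s hs => hthinF s (by linarith [hs.1])) x
  -- one sheet, and a graphical cross-section is a standard sphere
  have hinj := Summit.SmoothPoincare4.SmoothPoincare4.Theorems.CylinderRungTwo.KillingFlux.stub_oneSheet
    M (F 1) (hflow.isSmoothEmbedding _ h01) (hflow.mem_cyl _ h01) himm
  exact Summit.SmoothPoincare4.SmoothPoincare4.Theorems.CylinderRungTwo.KillingFlux.stub_graphicalIsSphere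
    M (F 1) (hflow.isSmoothEmbedding _ h01) (hflow.mem_cyl _ h01) ⟨hinj, himm⟩

/-- **Chain α (alternative composition, kernel-checked in the tree as p83106, Cheeger–Yau discharged; REDUNDANT after β):** the
crux from the full CMS conjunction and slab confinement, both explicit hypotheses since reshape r10 (the former `stub_slabConfinement`
is unregistered; the tree's α reduction is stated against the CMS conjunction and it too applies only clause (b)). -/
theorem SliceIsolation_of_slab (hslab : SlabConfinementStatement) (hCMS : ChodoshMantoulidisSchulze2025_lowEntropy_sphere_four) :
    SliceIsolation :=
  Summit.SmoothPoincare4.SmoothPoincare4.Theorems.CylinderEntropySliceIsolation.sliceIsolation_of_slabConfinement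
    hCMS CheegerYauZonalSphereFour_holds hslab

end Summit.SmoothPoincare4.SmoothPoincare4.Cruxes.SliceIsolation.ConformalKernelDomination

end
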